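import Mathlib
import Summits.ResolutionOfSingularities.ResolutionOfSingularities.Theorems.RadicialJungCleanModelsPointChainCleanPermSeq
import Summits.ResolutionOfSingularities.ResolutionOfSingularities.Theorems.RadicialJungCleanModelsCurveDimensionData
import HarnessLib

/-!
# Route `RadicialJung`, crux `CleanModels` (stmt-ResolutionOfSingularities-15917), line `Sketch` rev 35, stub 6 `stub_cleanProp44` (X44c),
# the CURVE-CENTRE STEP of X44c in its OUTPUT CURRENCY `IsCleanPermissibleSeq p π J μ J' G`

Memo `Cruxes/CleanModels/Lines/Sketch-memo-hand2-g10-stubs-5-7.md` §3.  The X44c conclusion is a clean-permissible sequence for the idealistic exponent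
`(J, μ)` (centres inside `{ord = μ}` of the iterated controlled transform).  Inside such a sequence `π : X₁ → X` (line of `G` clean-regular everywhere on
`X`, `char p`; `X₁` Noetherian regular quasi-excellent with `dim 𝒪 ≤ 3`; `ord J₁ ≤ μ` everywhere), a regular curve `C₀ = cl{η}` INSIDE THE STRATUM
`{ord J₁ = μ}` — [CoP1] Prop. 4.4's one-dimensional centres — is first made clean-permissible at every point by finitely many chains of point blow-ups
(L7b-global, induction on the finite bad set ✓ `finite_setOf_not_cleanPermissibleAt_of_cleanRegAt_genericPoint`, each chain a legal extension of the
sequence ✓ `IsPointChainAlong.isCleanPermissibleSeq`), and then its strict transform `C = cl{η'}` (still inside `{ord = μ}`) is blown up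
(`IsCleanPermissibleSeq.cons`): `exists_isCleanPermissibleSeq_forall_cleanPermissibleAt_of_ncard_le` (the induction) and
`exists_isCleanPermissibleSeq_blowup_curve` (the curve-centre step; `ord ≤ μ` persists ✓ `IsBlowup.idealOrder_controlledTransform_le_of_forall`).

Honest framing: OURS; this is the clean version of the curve-centre move of [CoP1] Prop. 4.4 / [CJS 2020] Thm. 6.28 Step 5, i.e. the insertion that
O6's re-threading of the in-tree `CP2008Prop44` assembly must call; the termination bookkeeping (O6) and O1–O5, O7 are untouched; nothing here proves
X44c, resolution in characteristic `p`, or any case of `CleanModels`.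
-/

noncomputable section

set_option linter.dupNamespace false -- mandated namespace of this single-conjunct summit

open CategoryTheory AlgebraicGeometry TopologicalSpace IsLocalRing Opposite
open Literature.AlgebraicGeometry.Resolution Literature.AlgebraicGeometry.Motives
open Scheme.IdealSheafData

namespace Summit.ResolutionOfSingularities.ResolutionOfSingularities.Theorems.RadicialJung.CleanModels

/-- **L7b-global inside a clean-permissible sequence for `(J, μ)`** (induction on the number `≤ N` of bad points).  See the module docstring.
[cite: CossartPiltant2008, Prop. 4.4 (proof, p. 10)] [cite: CossartPiltant2008, Prop. 4.2 (a)] [cite: Piltant2013, §2 Axiom 4] -/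
theorem exists_isCleanPermissibleSeq_forall_cleanPermissibleAt_of_ncard_le (p : ℕ) [hp : Fact p.Prime] (N : ℕ) :
    ∀ {X X₁ : Scheme.{0}} [IsIntegral X] [IsIntegral X₁] [IsNoetherian X₁] {π : X₁ ⟶ X} [IsDominant π] {J : X.IdealSheafData} {μ : ℕ}
      {J₁ : X₁.IdealSheafData} {G : X.functionField} [CharP X.functionField p] (_ : IsCleanPermissibleSeq p π J μ J₁ G)
      (_ : ∀ x : X, CleanRegAt p (algebraMap (X.presheaf.stalk x) X.functionField) G)
      (_ : Scheme.IsRegular X₁) (_ : Scheme.IsQuasiExcellent X₁) (_ : ∀ x : X₁, idealOrder J₁ x ≤ μ) {C₀ : Closeds X₁}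
      (_ : ∀ y ∈ (C₀ : Set X₁), ∃ c : Fin 2 → X₁.presheaf.stalk y, IsRsopPart c ∧ Ideal.span (Set.range c) = stalkIdeal (vanishingIdeal C₀) y)
      {η : X₁} (_ : (C₀ : Set X₁) = closure {η}) (_ : ∀ y ∈ (C₀ : Set X₁), y ≠ η → IsClosed ({y} : Set X₁))
      (_ : ∀ y ∈ (C₀ : Set X₁), y ≠ η → ringKrullDim (X₁.presheaf.stalk y) = 3) (_ : ∀ y ∈ (C₀ : Set X₁), idealOrder J₁ y = μ)
      (G₁ : X₁.functionField) (_ : G₁ = RatFn.functionFieldMap π G)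
      (_ : {y : X₁ | y ∈ (C₀ : Set X₁) ∧ ¬ CleanPermissibleAt p (RatFn.toFunctionField y) G₁ (stalkIdeal (vanishingIdeal C₀) y)}.Finite)
      (_ : {y : X₁ | y ∈ (C₀ : Set X₁) ∧ ¬ CleanPermissibleAt p (RatFn.toFunctionField y) G₁ (stalkIdeal (vanishingIdeal C₀) y)}.ncard ≤ N),
    ∃ (X' : Scheme.{0}) (_ : IsIntegral X') (_ : IsNoetherian X') (σ : X' ⟶ X₁) (_ : IsDominant σ) (C : Closeds X') (η' : X')
      (J' : X'.IdealSheafData),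
      IsCleanPermissibleSeq p (σ ≫ π) J μ J' G ∧ IsProper σ ∧ Scheme.IsRegular X' ∧ Scheme.IsQuasiExcellent X' ∧
      (∀ y ∈ (C : Set X'), ∃ c : Fin 2 → X'.presheaf.stalk y, IsRsopPart c ∧ Ideal.span (Set.range c) = stalkIdeal (vanishingIdeal C) y) ∧
      (C : Set X') = closure {η'} ∧ σ η' = η ∧ (∀ x' : X', idealOrder J' x' ≤ μ) ∧ (∀ y ∈ (C : Set X'), idealOrder J' y = μ) ∧
      ∀ y ∈ (C : Set X'), CleanPermissibleAt p (RatFn.toFunctionField y) (RatFn.functionFieldMap σ G₁) (stalkIdeal (vanishingIdeal C) y) := by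
  induction N with
  | zero =>
    intro X X₁ _ _ _ π _ J μ J₁ G _ hπ hG hX₁ hE₁ hJ₁le C₀ hC₀reg η hη hcl hdim3 hC₀μ G₁ hG₁ hfin hN
    have hgood : ∀ y ∈ (C₀ : Set X₁), CleanPermissibleAt p (RatFn.toFunctionField y) G₁ (stalkIdeal (vanishingIdeal C₀) y) := by
      intro y hy
      by_contra hbad
      have h0 := (Set.ncard_eq_zero hfin).mp (Nat.le_zero.mp hN)
      have hmem : y ∈ {y : X₁ | y ∈ (C₀ : Set X₁) ∧
          ¬ CleanPermissibleAt p (RatFn.toFunctionField y) G₁ (stalkIdeal (vanishingIdeal C₀) y)} := ⟨hy, hbad⟩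
      rw [h0] at hmem
      exact hmem
    refine ⟨X₁, inferInstance, inferInstance, 𝟙 X₁, inferInstance, C₀, η, J₁, by simpa using hπ, inferInstance, hX₁, hE₁, hC₀reg, hη, rfl,
      hJ₁le, hC₀μ, ?_⟩
    intro y hy
    rw [RatFn.functionFieldMap_id, RingHom.id_apply]
    exact hgood y hy
  | succ N ih =>
    intro X X₁ _ _ _ π _ J μ J₁ G _ hπ hG hX₁ hE₁ hJ₁le C₀ hC₀reg η hη hcl hdim3 hC₀μ G₁ hG₁ hfin hN
    classical
    haveI : CharP X₁.functionField p := charP_of_injective_ringHom (RatFn.functionFieldMap π).injective p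
    have hclean : ∀ x : X₁, CleanRegAt p (RatFn.toFunctionField x) G₁ := by
      intro x; rw [hG₁]; exact hπ.cleanRegAt hp.out inferInstance hG x
    have hηgood : CleanPermissibleAt p (RatFn.toFunctionField η) G₁ (stalkIdeal (vanishingIdeal C₀) η) :=
      cleanPermissibleAt_genericPoint_of_cleanRegAt p hη G₁ (hclean η)
    by_cases hle : {y : X₁ | y ∈ (C₀ : Set X₁) ∧
        ¬ CleanPermissibleAt p (RatFn.toFunctionField y) G₁ (stalkIdeal (vanishingIdeal C₀) y)}.ncard ≤ N
    · exact ih hπ hG hX₁ hE₁ hJ₁le hC₀reg hη hcl hdim3 hC₀μ G₁ hG₁ hfin hle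
    have hne : {y : X₁ | y ∈ (C₀ : Set X₁) ∧
        ¬ CleanPermissibleAt p (RatFn.toFunctionField y) G₁ (stalkIdeal (vanishingIdeal C₀) y)}.Nonempty := by
      rw [Set.nonempty_iff_ne_empty]
      intro h0
      apply hle
      rw [h0, Set.ncard_empty]; exact Nat.zero_le _
    obtain ⟨x₀, hx₀C, hx₀bad⟩ := hne
    have hx₀η : x₀ ≠ η := by rintro rfl; exact hx₀bad hηgood
    -- the descent step: one chain at `x₀`
    obtain ⟨X₂, hX₂i, hX₂n, σ₁, hσ₁d, C₁, x₁, n₁, hchain, hσx, hx₁cl, hx₁good, hfin₁, hlt⟩ :=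
      exists_pointChain_good_ncard_bad_lt hX₁ hE₁ p hC₀reg hη hcl hdim3 G₁ hfin hx₀C hx₀η hx₀bad (hclean x₀)
    subst hσx
    have hx₀cl : IsClosed ({σ₁ x₁} : Set X₁) := hcl _ hx₀C hx₀η
    have hdim₀ : ringKrullDim (X₁.presheaf.stalk (σ₁ x₁)) = 3 := hdim3 _ hx₀C hx₀η
    have h0 : σ₁ x₁ ∈ closure ((C₀ : Set X₁) \ {σ₁ x₁}) := by
      have hsub : ({η} : Set X₁) ⊆ (C₀ : Set X₁) \ {σ₁ x₁} := by
        rintro z hz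
        rw [Set.mem_singleton_iff] at hz
        subst hz
        exact ⟨by rw [hη]; exact subset_closure rfl, fun heq => hx₀η (Set.mem_singleton_iff.mp heq).symm⟩
      have h1 := closure_mono hsub
      rw [← hη] at h1
      exact h1 hx₀C
    obtain ⟨hX₂, hC₁reg, -, -⟩ := data_along_pointChain hchain hX₁ hC₀reg hx₀C hdim₀
    have hE₂ : Scheme.IsQuasiExcellent X₂ := hchain.isQuasiExcellent hE₁
    obtain ⟨η₁, hη₁C, hση₁, hη₁, hcl₁, hdim3₁, hoff⟩ := hchain.curve_data hX₁ hC₀reg hη hcl hdim3 hx₀C hx₀η hx₁cl p G₁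
    -- the chain is a legal extension of the clean-permissible sequence
    obtain ⟨_, _, J₂, hseq₂, hJ₂le, hC₁μ, -⟩ :=
      hchain.isCleanPermissibleSeq hp.out hπ hG hX₁ hE₁ hJ₁le hC₀reg hC₀μ hx₀C hdim₀ hx₀cl h0
    haveI : IsProper σ₁ := hchain.isProper
    haveI : CompactSpace X₂ := QuasiCompact.compactSpace_of_compactSpace σ₁
    haveI : IsNoetherian X₂ := {}
    have hG₂ : RatFn.functionFieldMap σ₁ G₁ = RatFn.functionFieldMap (σ₁ ≫ π) G := by
      rw [hG₁, RatFn.functionFieldMap_comp π σ₁, RingHom.comp_apply]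
    have hN₁ : {y : X₂ | y ∈ (C₁ : Set X₂) ∧
        ¬ CleanPermissibleAt p (RatFn.toFunctionField y) (RatFn.functionFieldMap σ₁ G₁) (stalkIdeal (vanishingIdeal C₁) y)}.ncard ≤ N := by
      omega
    obtain ⟨X₃, hX₃i, hX₃n, σ₂, hσ₂d, C₂, η₂, J₃, hseq₃, hprop₃, hX₃, hE₃, hC₂reg, hη₂, hση₂, hJ₃le, hC₂μ, hall⟩ :=
      ih hseq₂ hG hX₂ hE₂ hJ₂le hC₁reg hη₁ hcl₁ hdim3₁ hC₁μ (RatFn.functionFieldMap σ₁ G₁) hG₂ hfin₁ hN₁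
    haveI := hprop₃
    refine ⟨X₃, hX₃i, hX₃n, σ₂ ≫ σ₁, inferInstance, C₂, η₂, J₃, by simpa only [Category.assoc] using hseq₃, inferInstance, hX₃, hE₃, hC₂reg,
      hη₂, ?_, hJ₃le, hC₂μ, ?_⟩
    · rw [Scheme.Hom.comp_apply, hση₂, hση₁]
    · intro y hy
      rw [RatFn.functionFieldMap_comp σ₁ σ₂, RingHom.comp_apply]
      exact hall y hy

/-- **The curve-centre step of [CoP1] Prop. 4.4, clean version, in X44c's output currency.**  Inside a clean-permissible sequence `π : X₁ → X` for
`(J, μ)` with transform `J₁` (`ord J₁ ≤ μ`; line of `G` clean-regular everywhere on `X`, `char p`; `X₁` Noetherian regular quasi-excellent with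
`dim 𝒪 ≤ 3`), a regular curve `C₀ = cl{η}` of the stratum `{ord J₁ = μ}` is made clean-permissible by `σ` and its strict transform `C = cl{η'}` blown up
by `τ`; the composite `τ ≫ σ ≫ π` is again a clean-permissible sequence for `(J, μ)`, with transform the controlled transform of `J'`, of order `≤ μ`
everywhere. [cite: CossartPiltant2008, Prop. 4.4 and Prop. 4.2 (a)] [cite: CossartJannsenSaito2020, proof of Thm. 6.28, Step 5] [cite: Piltant2013, §2 Axiom 4] -/
theorem exists_isCleanPermissibleSeq_blowup_curve (p : ℕ) [hp : Fact p.Prime] {X X₁ : Scheme.{0}} [IsIntegral X] [IsIntegral X₁]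
    [IsNoetherian X₁] {π : X₁ ⟶ X} [IsDominant π] {J : X.IdealSheafData} {μ : ℕ} {J₁ : X₁.IdealSheafData} {G : X.functionField}
    [CharP X.functionField p] (hπ : IsCleanPermissibleSeq p π J μ J₁ G)
    (hG : ∀ x : X, CleanRegAt p (algebraMap (X.presheaf.stalk x) X.functionField) G) (hX₁ : Scheme.IsRegular X₁)
    (hE₁ : Scheme.IsQuasiExcellent X₁) (hX3 : ∀ x : X₁, ringKrullDim (X₁.presheaf.stalk x) ≤ 3) (hJ₁le : ∀ x : X₁, idealOrder J₁ x ≤ μ)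
    {C₀ : Closeds X₁}
    (hC₀reg : ∀ y ∈ (C₀ : Set X₁), ∃ c : Fin 2 → X₁.presheaf.stalk y, IsRsopPart c ∧ Ideal.span (Set.range c) = stalkIdeal (vanishingIdeal C₀) y)
    {η : X₁} (hη : (C₀ : Set X₁) = closure {η}) (hC₀μ : ∀ y ∈ (C₀ : Set X₁), idealOrder J₁ y = μ) :
    ∃ (X' : Scheme.{0}) (_ : IsIntegral X') (_ : IsNoetherian X') (σ : X' ⟶ X₁) (_ : IsDominant σ) (C : Closeds X') (η' : X')
      (J' : X'.IdealSheafData) (X'' : Scheme.{0}) (_ : IsIntegral X'') (_ : IsNoetherian X'') (τ : X'' ⟶ X') (_ : IsDominant τ),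
      (C : Set X') = closure {η'} ∧ σ η' = η ∧
      (∀ y ∈ (C : Set X'), ∃ c : Fin 2 → X'.presheaf.stalk y, IsRsopPart c ∧ Ideal.span (Set.range c) = stalkIdeal (vanishingIdeal C) y) ∧
      (∀ y ∈ (C : Set X'), idealOrder J' y = μ) ∧ (∀ x' : X', idealOrder J' x' ≤ μ) ∧
      IsCleanPermissibleSeq p (σ ≫ π) J μ J' G ∧ IsBlowup τ (vanishingIdeal C) ∧
      IsCleanPermissibleSeq p (τ ≫ σ ≫ π) J μ (controlledTransform τ (vanishingIdeal C) J' μ) G ∧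
      ∀ x'' : X'', idealOrder (controlledTransform τ (vanishingIdeal C) J' μ) x'' ≤ μ := by
  haveI : CharP X₁.functionField p := charP_of_injective_ringHom (RatFn.functionFieldMap π).injective p
  obtain ⟨hdimη, hcl, hdim3⟩ := curve_dimension_data hX3 hC₀reg hη
  have hclean : ∀ x : X₁, CleanRegAt p (RatFn.toFunctionField x) (RatFn.functionFieldMap π G) :=
    fun x => hπ.cleanRegAt hp.out inferInstance hG x
  have hfin := finite_setOf_not_cleanPermissibleAt_of_cleanRegAt_genericPoint hX₁ hE₁ p hC₀reg hη hdimη hcl _ (hclean η)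
  obtain ⟨X', hX'i, hX'n, σ, hσd, C, η', J', hseq, hprop, hX', hE', hCreg, hη', hση', hJ'le, hCμ, hall⟩ :=
    exists_isCleanPermissibleSeq_forall_cleanPermissibleAt_of_ncard_le p _ hπ hG hX₁ hE₁ hJ₁le hC₀reg hη hcl hdim3 hC₀μ
      (RatFn.functionFieldMap π G) rfl hfin le_rfl
  haveI := hX'i
  haveI := hX'n
  haveI := hσd
  -- the centre `C`: nonzero, integral, regular
  have hη'C : η' ∈ (C : Set X') := by rw [hη']; exact subset_closure rfl
  have hYbot : vanishingIdeal C ≠ ⊥ := by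
    intro hbot
    obtain ⟨c, hc, hspan⟩ := hCreg η' hη'C
    haveI := hc.1
    have hc0 : c 0 ∈ stalkIdeal (vanishingIdeal C) η' := hspan ▸ Ideal.subset_span ⟨0, rfl⟩
    rw [hbot, stalkIdeal_bot, Ideal.mem_bot] at hc0
    exact hc.ne_zero 0 hc0
  have hint : IsIntegral (vanishingIdeal C).subscheme :=
    ComponentGluing.isIntegral_subscheme_vanishingIdeal C (by rw [hη']; exact isIrreducible_singleton.closure)
  have hreg : Scheme.IsRegular (vanishingIdeal C).subscheme :=
    isRegular_subscheme_vanishingIdeal_of_forall_isRsopPart fun x hx => by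
      obtain ⟨c, hc, h⟩ := hCreg x hx
      exact ⟨2, c, hc, h⟩
  set τ := blowup.π (vanishingIdeal C) with hτdef
  have hτ : IsBlowup τ (vanishingIdeal C) := blowup.isBlowup _
  haveI : IsIntegral (blowup (vanishingIdeal C)) := hτ.isIntegral hYbot
  haveI : IsDominant τ := isDominant_of_isBlowup_of_ne_bot hτ hYbot
  haveI : IsProper τ := hτ.isProper
  haveI : CompactSpace (blowup (vanishingIdeal C)) := QuasiCompact.compactSpace_of_compactSpace τ
  haveI : IsLocallyNoetherian (blowup (vanishingIdeal C)) := LocallyOfFiniteType.isLocallyNoetherian τ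
  haveI : IsNoetherian (blowup (vanishingIdeal C)) := {}
  have hperm : ∀ y ∈ (C : Set X'), CleanPermissibleAt p (algebraMap (X'.presheaf.stalk y) X'.functionField)
      (RatFn.functionFieldMap (σ ≫ π) G) (stalkIdeal (vanishingIdeal C) y) := by
    intro y hy
    rw [RatFn.functionFieldMap_comp π σ, RingHom.comp_apply]
    exact hall y hy
  have hcons : IsCleanPermissibleSeq p (τ ≫ σ ≫ π) J μ (controlledTransform τ (vanishingIdeal C) J' μ) G :=
    IsCleanPermissibleSeq.cons τ (σ ≫ π) J μ J' G C hseq hint hreg hCμ hτ hperm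
  have hle'' : ∀ x'', idealOrder (controlledTransform τ (vanishingIdeal C) J' μ) x'' ≤ μ :=
    fun x'' => hτ.idealOrder_controlledTransform_le_of_forall hX' hreg hCμ hJ'le x''
  exact ⟨X', hX'i, hX'n, σ, hσd, C, η', J', blowup (vanishingIdeal C), inferInstance, inferInstance, τ, inferInstance, hη', hση', hCreg, hCμ,
    hJ'le, hseq, hτ, hcons, hle''⟩

end Summit.ResolutionOfSingularities.ResolutionOfSingularities.Theorems.RadicialJung.CleanModels

end
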